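/-
Copyright (c) 2026 the pub-hodgecm-mathlib formalisation cell (harness21).  Prover seat hodgecm-mathlib-K2E1-p13 (g2), Track B ∕ K2-LIT, h413 = `stmt-HodgeConjecture-24833`,
line `K2_E1_TraceFormulaBeta`, ROADCARD «5Res ENDGAME BY FAMILIES» (dealer K2E1-plan (g7) (214)∕(219)): the payer structure of the letter (hconj) `c(conj z) = conj c(z)` of ★
`K2E1ChiUnitaryAxisContinuationCMTwo` — FILE A: the reflection principle made kernel-free, its `(P, c)` packaging, and the conjugate of the Godement-range coefficient.
-/
import Summits.HodgeConjecture.HodgeConjecture.Theorems.K2E1ScalarUnitaryAxisContinuationCMTwo   -- ★ (136): brings ★ T2 (`K2E1ScatteringUnitaryAxisCMTwo`), ★ `differentiableOn_conj_comp_conj`, ★ `conj_ofReal_cpow`, ★ `countable_of_codiscrete`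
import HarnessLib

/-!
# `K2E1ChiScatteringConjSymmetryCMTwo` (FILE A) — THE REFLECTION SYMMETRY `c(conj z) = conj c(z)` OF A SCATTERING SCALAR REDUCED TO THE TUBE, AND THE CONJUGATE OF THE
# GODEMENT-RANGE COEFFICIENT (`conj c_{φ,φ′}(z) = c_{φ̄,φ̄′}(conj z)`)

Track B ∕ K2-LIT, crux h413 = `stmt-HodgeConjecture-24833`, route of record `HCCMUnconditional`; cell `hodgecm-mathlib`, squad K2, ENGINE E1.  THEOREMS ONLY (no `def`, no `instance`,
no `notation`, no `sorry`; default heartbeats); lane `--supports stmt-HodgeConjecture-24833 --as helper` (count-neutral).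

THE MATHEMATICS ([MoeglinWaldspurger1995, II.1.6–II.1.7, IV.1.10]; [Langlands1976, §7]; [Iwaniec2002, §6.3]).  The letter (hconj) of ★ `K2E1ChiUnitaryAxisContinuationCMTwo` asks, for the
scattering scalar `c = c(·; χ)` of a SELF-DUAL family (NF-meromorphic, analytic off a closed co-discrete `P ⊆ {Re ≤ 1}`), `c(conj z) = conj c(z)` off `P ∪ conj P`.  For `χ = 1` ★ T2b
(`apply_conj_eq_conj_apply_of_tube`) proves it from the POSITIVE REAL KERNEL `c(z) = ∫ H^z dμ`; for `χ ≠ 1` the kernel `f_z^φ(w₀v)` carries the phases of `χ`, and the right road is: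
(H1) `conj` of the Godement-range coefficient is the coefficient of the CONJUGATE data at `conj z` — `conj f_z^φ = f_{conj z}^{conj∘φ}` (`H > 0`: ★ `conj_ofReal_cpow`), Mathlib
`integral_conj`; (H2) GALOIS-CONJUGATION INVARIANCE `c_{φ∘c_G, φ′∘c_G}(w) = c_{φ,φ′}(w)` (`c_G` = the Galois twist of `U(1,1)(𝔸_{L⁺})` by `c ∈ Gal(L∕L⁺)`: height, Borel, `K_max`, Haar on
`N(𝔸)` are `c_G`-stable — infrastructure NOT yet in the tree, see the census on the K2 bus 2026-09-04); (H3) reality of the normalised M1 sections of a self-dual unitary `χ`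
(`conj χ = χ∘c`, `φ(1) ∈ ℝ` ⇒ `conj∘φ = φ∘c_G`).  (H1)–(H3) give the TUBE identity `c(conj z) = conj c(z)` for `1 < Re z`; the identity theorem globalises it.  THIS FILE:
* §1 **`apply_conj_eq_conj_apply_of_tube'`** — ★ T2b KERNEL-FREE: `U` open, preconnected, conjugation-symmetric, `⊇ {Re > 1}`; `c` holomorphic on `U`; the tube identity
  **(htube)** `∀ z, 1 < Re z → c(conj z) = conj c(z)` ⟹ `c(conj z) = conj c(z)` on `U` (Schwarz reflection ★ `differentiableOn_conj_comp_conj` + identity theorem).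
* §2 **`apply_conj_eq_conj_apply_of_tube_of_poleSet`** — the `(P, c)` packaging in (hconj)'s EXACT shape: `P` closed co-discrete `⊆ {Re ≤ 1}`, `c` analytic off `P`, (htube) ⟹
  `∀ z, z ∉ P → conj z ∉ P → c(conj z) = conj c(z)` (`V = (P ∪ conj⁻¹P)ᶜ` as ★ (136) §2).  So (hconj) is REDUCED TO THE TUBE LETTER, whose payer is (H1)+(H2)+(H3).
* §3 (H1) **`conj_integral_flatSectionU`** — `conj ∫ f_z^φ(p x) dμ = ∫ f_{conj z}^{conj∘φ}(p x) dμ` for any measurable parametrisation `p` (e.g. `v ↦ w₀·v·g` on `N(𝔸)`), and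
  **`conj_godementCoeffFun`** — the conjugate of ★ X1_χ §2a's coefficient function `(ν𝓕)⁻¹ • (g ↦ (∫ f_z^φ(w₀ v g) dν)·H(g)^{z−1})` is the same function of the conjugate data at `conj z`.
HONEST LABEL: HC_CM is proved only modulo the 7 printed citations (2 remaining named inputs: hLiu418 = `stmt-HodgeConjecture-24832`, h413 = `stmt-HodgeConjecture-24833`) until rung 0
closes; this file asserts no named fact, closes no socket; count-neutral; letter `htube` ((H2)+(H3): Galois twist of the quasi-split datum — to be dealt).
[cite: MoeglinWaldspurger1995, II.1.6–II.1.7 and IV.1.10] [cite: Langlands1976, §7] [cite: Iwaniec2002, §6.3]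

## References
* [MoeglinWaldspurger1995] C. Mœglin, J.-L. Waldspurger, *Spectral decomposition and Eisenstein series* (1995), II.1.6–II.1.7, IV.1.10.
* [Langlands1976] R. P. Langlands, *On the Functional Equations Satisfied by Eisenstein Series*, LNM 544 (1976), §7.
* [Iwaniec2002] H. Iwaniec, *Spectral Methods of Automorphic Forms* (2nd ed., 2002), §6.3.
-/

set_option autoImplicit false
set_option linter.dupNamespace false  -- the mandated namespace repeats the summit's segment (`HodgeConjecture.HodgeConjecture`)

noncomputable section

open MeasureTheory Measure Set Filter Topology Complex NumberField
open scoped Real NNReal ENNReal ComplexConjugate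
open Literature.NumberTheory.Automorphic Literature.NumberTheory.Automorphic.UnitaryGroup AdelicGroupData
open Summit.HodgeConjecture.HodgeConjecture.Cruxes.H413.K2E1BorelEisensteinU
open Summit.HodgeConjecture.HodgeConjecture.Cruxes.H413.K2E1MaassSelbergContinuedCMTwo (differentiableOn_conj_comp_conj)
open Summit.HodgeConjecture.HodgeConjecture.Cruxes.H413.K2E1MaassSelbergPoleControl (conj_ofReal_cpow)
open Summit.HodgeConjecture.HodgeConjecture.Cruxes.H413.K2E1ConvexDiffCountableConnected (countable_of_codiscrete isPreconnected_convex_diff_of_countable)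

namespace Summit.HodgeConjecture.HodgeConjecture.Cruxes.H413.K2E1ChiScatteringConjSymmetryCMTwo

/-! ## §1 The reflection principle, kernel-free: from the tube identity to the whole domain -/

/-- **`c(conj z) = conj c(z)` ON `U` FROM THE TUBE** (★ T2b `apply_conj_eq_conj_apply_of_tube` with the positive-kernel hypothesis replaced by the tube identity itself): `U ⊆ ℂ` open,
preconnected, conjugation-symmetric, containing `{Re z > 1}`; `c` holomorphic on `U`; `c(conj z) = conj c(z)` for `1 < Re z`.  THEN the same holds on all of `U`: `z ↦ conj c(conj z)` is
holomorphic on `U` (Schwarz reflection ★ `differentiableOn_conj_comp_conj`) and equals `c` on the open tube, hence on `U` (identity theorem). [cite: MoeglinWaldspurger1995, IV.1.10] [cite: Langlands1976, §7] -/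
theorem apply_conj_eq_conj_apply_of_tube' {U : Set ℂ} (hU : IsOpen U) (hUc : IsPreconnected U) (hUsym : ∀ z ∈ U, conj z ∈ U)
    (hUtube : {z : ℂ | 1 < z.re} ⊆ U) {c : ℂ → ℂ} (hc : DifferentiableOn ℂ c U) (htube : ∀ z : ℂ, 1 < z.re → c (conj z) = conj (c z)) :
    ∀ z ∈ U, c (conj z) = conj (c z) := by
  -- the reflected function `g z := conj (c (conj z))`, holomorphic on `conj⁻¹U = U`
  have hpre : {w : ℂ | conj w ∈ U} = U := by
    ext w
    refine ⟨fun h => ?_, fun h => hUsym w h⟩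
    have := hUsym _ h
    rwa [Complex.conj_conj] at this
  have hg : DifferentiableOn ℂ (fun z : ℂ => conj (c (conj z))) U := by
    have h := differentiableOn_conj_comp_conj hU hc
    rwa [hpre] at h
  -- `g = c` on the open tube
  have h2 : (2 : ℂ) ∈ U := hUtube (by simp)
  have hev : (fun z : ℂ => conj (c (conj z))) =ᶠ[𝓝 (2 : ℂ)] c := by
    have hopen : IsOpen {z : ℂ | 1 < z.re} := isOpen_lt continuous_const Complex.continuous_re
    filter_upwards [hopen.mem_nhds (show (2 : ℂ) ∈ {z : ℂ | 1 < z.re} by simp)] with z hz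
    rw [htube z hz, Complex.conj_conj]
  -- identity theorem on the preconnected `U`
  have heq := (hg.analyticOnNhd hU).eqOn_of_preconnected_of_eventuallyEq (hc.analyticOnNhd hU) hUc h2 hev
  intro z hz
  have h := heq (hUsym z hz)
  simp only [Complex.conj_conj] at h
  exact h.symm

/-! ## §2 The `(P, c)` packaging: (hconj)'s exact shape from the tube letter -/

/-- **(hconj) FROM THE TUBE LETTER.**  `P` closed, co-discrete, `⊆ {Re ≤ 1}` and `c` analytic off `P` (★ X2∕X2_χ's (E3)-type clauses); the tube identity `c(conj z) = conj c(z)` for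
`1 < Re z`.  THEN `c(conj z) = conj c(z)` whenever `z ∉ P`, `conj z ∉ P` — §1 on `V = (P ∪ conj⁻¹P)ᶜ` (open; preconnected as the complement of a countable set, ★
`isPreconnected_convex_diff_of_countable`; conjugation-symmetric; `⊇ {Re > 1}` since `P ⊆ {Re ≤ 1}`). [cite: MoeglinWaldspurger1995, IV.1.10] [cite: Langlands1976, §7] -/
theorem apply_conj_eq_conj_apply_of_tube_of_poleSet {P : Set ℂ} {c : ℂ → ℂ} (hPc : IsClosed P) (hPcd : ∀ z₀ : ℂ, ∀ᶠ s in 𝓝[≠] z₀, s ∉ P) (hPre : ∀ z ∈ P, z.re ≤ 1)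
    (hcan : ∀ z : ℂ, z ∉ P → AnalyticAt ℂ c z) (htube : ∀ z : ℂ, 1 < z.re → c (conj z) = conj (c z)) :
    ∀ z : ℂ, z ∉ P → conj z ∉ P → c (conj z) = conj (c z) := by
  intro z hz hz'
  set V : Set ℂ := (P ∪ {w : ℂ | conj w ∈ P})ᶜ with hV
  have hVo : IsOpen V := (hPc.union (hPc.preimage continuous_conj)).isOpen_compl
  have hconjP : {w : ℂ | conj w ∈ P} = (starRingEnd ℂ) '' P := by
    ext w
    refine ⟨fun h => ⟨conj w, h, conj_conj w⟩, ?_⟩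
    rintro ⟨u, hu, rfl⟩
    show conj (conj u) ∈ P
    rwa [conj_conj]
  have hVcount : (P ∪ {w : ℂ | conj w ∈ P}).Countable := (countable_of_codiscrete hPcd).union (by rw [hconjP]; exact (countable_of_codiscrete hPcd).image _)
  have hVpre : IsPreconnected V := by
    have e : V = univ \ (P ∪ {w : ℂ | conj w ∈ P}) := by ext w; simp [hV]
    rw [e]
    exact isPreconnected_convex_diff_of_countable Literature.Topology.Euclidean.one_lt_rank_real_complex convex_univ isOpen_univ hVcount
  have hVsym : ∀ w ∈ V, conj w ∈ V := fun w hw h => hw (by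
    rcases h with h | h
    · exact Or.inr h
    · rw [mem_setOf_eq, conj_conj] at h; exact Or.inl h)
  have hVtube : {w : ℂ | 1 < w.re} ⊆ V := fun w hw h => by
    rcases h with h | h
    · have := hPre w h; simp only [mem_setOf_eq] at hw; linarith
    · have := hPre _ h; rw [conj_re] at this; simp only [mem_setOf_eq] at hw; linarith
  have hcV : DifferentiableOn ℂ c V := fun w hw => (hcan w fun h => hw (Or.inl h)).differentiableAt.differentiableWithinAt
  exact apply_conj_eq_conj_apply_of_tube' hVo hVpre hVsym hVtube hcV htube z (fun h => h.elim hz hz')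

/-! ## §3 (H1) The conjugate of the Godement-range coefficient is the coefficient of the conjugate data at `conj z` -/

section Conj

variable {F E : Type} [Field F] [NumberField F] [Field E] [NumberField E] [Algebra F E] {c : E ≃ₐ[F] E} {N : ℕ} [NeZero N]

/-- **`conj f_z^φ = f_{conj z}^{conj ∘ φ}` pointwise**: `f_z^φ(g) = φ(g)·H(g)^z` with `H(g) > 0` real (★ `conj_ofReal_cpow`). [cite: MoeglinWaldspurger1995, II.1.5] -/
theorem conj_flatSectionU (φ : (quasiSplit F E c N).Adelic → ℂ) (z : ℂ) (g : (quasiSplit F E c N).Adelic) :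
    conj (flatSectionU φ z g) = flatSectionU (fun x => conj (φ x)) (conj z) g := by
  have hpos : (0 : ℝ) < ((borelHeight g : ℝ≥0) : ℝ) := by exact_mod_cast borelHeight_pos g
  simp only [flatSectionU, map_mul, conj_ofReal_cpow hpos]

/-- **(H1) `conj ∫ f_z^φ(p x) dμ(x) = ∫ f_{conj z}^{conj∘φ}(p x) dμ(x)`** for any parametrisation `p` (e.g. `v ↦ w₀·(v·g)` on `N(𝔸)`, the intertwining integrand of ★ X1_χ §2a's `hbX`)
(Mathlib `integral_conj`). [cite: MoeglinWaldspurger1995, II.1.6–II.1.7] -/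
theorem conj_integral_flatSectionU {X : Type*} [MeasurableSpace X] (μ : Measure X) (φ : (quasiSplit F E c N).Adelic → ℂ) (z : ℂ) (p : X → (quasiSplit F E c N).Adelic) :
    conj (∫ x, flatSectionU φ z (p x) ∂μ) = ∫ x, flatSectionU (fun y => conj (φ y)) (conj z) (p x) ∂μ := by
  rw [← integral_conj]
  exact integral_congr_ae (Eventually.of_forall fun x => conj_flatSectionU φ z (p x))

/-- **THE CONJUGATE OF THE GODEMENT-RANGE COEFFICIENT FUNCTION** (★ X1_χ §2a `exists_chi_constantTerm_data_cm_two`'s `hbX` right-hand side, pointwise in `g`): with a REAL scalar `r`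
(`(ν𝓕)⁻¹`), `conj (r·(∫ f_z^φ(p_g x) dμ)·H(g)^{z−1}) = r·(∫ f_{conj z}^{conj∘φ}(p_g x) dμ)·H(g)^{conj z − 1}` — the same coefficient function for the conjugate data `(conj∘φ, conj z)`.
Hence, expanding in a basis `φ′_j` and its conjugate basis `conj∘φ′_j`, the coordinates satisfy `conj (bX z)_j = b̄X (conj z)_j`. [cite: MoeglinWaldspurger1995, II.1.7, IV.1.10] -/
theorem conj_godementCoeffFun {X : Type*} [MeasurableSpace X] (μ : Measure X) (r : ℝ) (φ : (quasiSplit F E c N).Adelic → ℂ) (z : ℂ)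
    (p : (quasiSplit F E c N).Adelic → X → (quasiSplit F E c N).Adelic) (g : (quasiSplit F E c N).Adelic) :
    conj (((r : ℝ) : ℂ) * ((∫ x, flatSectionU φ z (p g x) ∂μ) * (((borelHeight g : ℝ≥0) : ℝ) : ℂ) ^ (z - 1))) =
      ((r : ℝ) : ℂ) * ((∫ x, flatSectionU (fun y => conj (φ y)) (conj z) (p g x) ∂μ) * (((borelHeight g : ℝ≥0) : ℝ) : ℂ) ^ (conj z - 1)) := by
  have hpos : (0 : ℝ) < ((borelHeight g : ℝ≥0) : ℝ) := by exact_mod_cast borelHeight_pos g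
  rw [map_mul, map_mul, Complex.conj_ofReal, conj_integral_flatSectionU, conj_ofReal_cpow hpos, map_sub, map_one]

end Conj

end Summit.HodgeConjecture.HodgeConjecture.Cruxes.H413.K2E1ChiScatteringConjSymmetryCMTwo

end
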